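import Summits.CriticalPhenomena.SAWScalingLimit.Theses.SAWTwistedSelfEnergy

/-!
# Birth skeleton for crux `TwistedGapEquation` (stmt-CriticalPhenomena-17874) — against the REPAIRED statement

Route `SAWTwistedSelfEnergy` of `CriticalPhenomena/SAWScalingLimit`, crux rank 4: "criticality of the `ℤ²` SAW is
the gap equation of the twisted resolvent in the spin sector" — for the recursion-defined spin-`5/8` twisted
self-energy `K`, the partial sums `Σ_{n ≤ N} x_c^n Σ_z Σ_k K_n(z)(E,k) i^k` converge to `1 − x_c (1 + 2 cos 3π/16)`.

**Registrar's finding (2026-08-17, kernel-checked in `Misstatement.lean` next to this file).**  As typed, the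
route's shared `let IsTwistedKernel K` leaves the slice `K 0 0` FREE (the recursion clause only sees `K m`,
`m ∈ Finset.Icc 1 n`; the support clause only kills `K 0 z`, `z ≠ 0`), while the crux's sum starts at `n = 0`.
Bumping `K 0 0` by `E₀₀` keeps `IsTwistedKernel` and shifts every partial sum by `1`, so
`TwistedGapEquation ↔ (∀ K, ¬ IsTwistedKernel K)`: the crux BY NAME is refutable (a kernel exists: the
`n ≥ 1` system is triangular) and NO honest stub set can imply it.  This file therefore types the skeleton
against the REPAIRED statement `TwistedGapEquationR` = the route's signature with the single clause `K 0 = 0 ∧`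
inserted at the head of the `IsTwistedKernel` let (repair R1: the kernel becomes literally unique, as the route
text "the recursion determines K uniquely" intends; the same insertion repairs `TwistedKernelLowOrder`).  Once the
route planner restates the item (`ledger route edit … --restate TwistedGapEquation --statement '<R1>'`, same decl
name), replace `TwistedGapEquationR` below by
`Summit.CriticalPhenomena.SAWScalingLimit.Theses.SAWTwistedSelfEnergy.TwistedGapEquation` (and `repaired_iff`
stays `Iff.rfl`): nothing else changes.

## The line — subcritical spin-sector resolvent ⊕ divergence at `x_c` ⊕ absolute summability (Abel/Tauber cut)

Write `κ_n := Σ_z Σ_k K_n(z)(E,k) i^k` (spin-sector zero-momentum symbol of the kernel), `g_n := Σ_z Σ_k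
G_n(z)(E,k) i^k` (same for the twisted two-point matrix; `= Σ_ω e^{i(3/8)W(ω)}` over `n`-step SAWs not starting
West, by `e^{−i(5/8)W} i^k = e^{i(3/8)W}`), `χ(x) := Σ_n g_n x^n`, `k(x) := Σ_n κ_n x^n`, `λ₁ = 1 + 2cos(3π/16)`
(spin-sector eigenvalue of `T`).  The route header's own reading of the crux ("conditional convergence AT `x_c`
plus Abel = ordinary summation") is cut into three named lemmas:

* `stub_spinResolventIdentity` (M/L; lattice symmetry + Cauchy products) — for `0 < x < x_c`, if `Σ |κ_n| x^n < ∞`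
  then `Σ |g_n| x^n < ∞` and `χ(x) · (1 − x λ₁ − k(x)) = 1`.  Mechanism: 90°-rotation covariance of
  `Ĝ_n(0)` turns the matrix recursion `Ĝ_n = Ĝ_{n−1} T̂ + Σ_m K̂_m Ĝ_{n−m}` into the SCALAR renewal equation
  `g_n = λ₁ g_{n−1} + Σ_{m=1}^{n} κ_m g_{n−m}`, `g_0 = 1`; `|g_n| ≤ c_n` and `c_n^{1/n} → μ` give the radius.
* `stub_spinSusceptibilityDiverges` (research-open, the critical-point content) — `‖χ(x)‖ → ∞` as `x ↑ x_c`: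
  the spin-`3/8`-twisted whole-plane susceptibility is critical at the UNtwisted `x_c = 1/μ` (winding phases
  cost only a power of `n`, predicted `n^{−O(1) · (3/8)²}` against `γ = 43/32`).
* `stub_spinKernelSummable` (research-open; the spin-sector shadow of the route's rank-2 crux
  `TwistedKernelSummable`, the declared dep of this crux) — `Σ_n x_c^n |κ_n| < ∞`, the Tauberian input.
* `TwistedGapEquationR_of` (kernel-checked): Weierstrass M-test ⇒ `k` continuous on `[0, x_c]`; on `(0, x_c)`
  the identity gives `1 − xλ₁ − k(x) = χ(x)⁻¹ → 0`; uniqueness of limits in `𝓝[<] x_c` ⇒ `k(x_c) = 1 − x_c λ₁`;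
  absolute convergence ⇒ the partial sums of the crux tend to `k(x_c)`.

No stub is the crux or the summit: A has no value, B is an identity below `x_c` conditional on summability,
C speaks of `G` only (9/9 cheap probes fail: `BirthRepaired.md`, § BC3).

Published as `Cruxes/TwistedGapEquation/BirthRepaired.lean` (NOT registered: `ledger skeleton check` wants the route decl by name,
which is refuted as typed).  After the restate: retarget the three occurrences of `TwistedGapEquationR` in §4 to the route decl,
drop `def TwistedGapEquationR`, `ledger crux write … Lines/birth.lean`, `ledger skeleton check … --crux stmt-CriticalPhenomena-17874`.
-/

noncomputable section

open Filter Topology Set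
open scoped BigOperators Topology Classical Matrix
open Literature.Probability.RandomPlanarGeometry Literature.Probability.LatticeModels

namespace Summit.CriticalPhenomena.SAWScalingLimit.Cruxes.TwistedGapEquation.Birth

/-! ### 1. Vocabulary: the route's shared `let` block, named (letter for letter) -/

/-- the four lattice directions `E, N, W, S` (the route's `let dir`) -/
def dir : Fin 4 → Site 2 := ![![1, 0], ![0, 1], ![-1, 0], ![0, -1]]

/-- the spin `σ = 5/8` (the route's `let σ`) -/
def spin : ℝ := 5 / 8

/-- the one-step twisted non-backtracking matrix `T` (the route's `let T`) -/
def stepMatrix : Matrix (Fin 4) (Fin 4) ℂ := fun a b =>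
  if dir b = -dir a then 0 else
    Complex.exp (-Complex.I * spin *
      (turning (-Site.toComplex (dir a)) 0 (Site.toComplex (dir b)) : ℝ))

/-- the twisted two-point matrices `G n z` (the route's `let G`): sum over `n`-step SAWs `0 → z` with fictitious
incoming step `ι` (first-step reversal excluded) and last step `κ` of `exp(−iσ · total turning)` -/
def twoPoint : ℕ → Site 2 → Matrix (Fin 4) (Fin 4) ℂ := fun n z ι κ =>
  if n = 0 then (if z = 0 ∧ ι = κ then 1 else 0) else
    ∑ p ∈ ((zdGraph 2).finsetWalkLength n (0 : Site 2) z).filter (fun p => p.IsPath),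
      (if p.getVert 1 = -dir ι ∨ z - p.getVert (n - 1) ≠ dir κ then 0 else
        Complex.exp (-Complex.I * spin *
          (winding ((-Site.toComplex (dir ι)) :: (p.support.map Site.toComplex)) : ℝ)))

/-- **REPAIRED** kernel predicate (R1): the route's `let IsTwistedKernel` with the clause `K 0 = 0` prepended, so
that the square resolvent recursion determines `K` uniquely (the `n = 0` slice is no longer free). -/
def IsTwistedKernel (K : ℕ → Site 2 → Matrix (Fin 4) (Fin 4) ℂ) : Prop :=
  K 0 = 0 ∧ (∀ n z, z ∉ box 2 n → K n z = 0) ∧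
  (∀ n, 1 ≤ n → ∀ z, twoPoint n z =
    Matrix.of (fun ι κ => ∑ κ' : Fin 4, twoPoint (n - 1) (z - dir κ) ι κ' * stepMatrix κ' κ) +
      ∑ m ∈ Finset.Icc 1 n, ∑ y ∈ box 2 m, K m y * twoPoint (n - m) (z - y))

/-- `κ_n`: spin-sector (weights `i^k`) zero-momentum coefficient of the kernel at length `n` -/
def kerCoeff (K : ℕ → Site 2 → Matrix (Fin 4) (Fin 4) ℂ) (n : ℕ) : ℂ :=
  ∑ z ∈ box 2 n, ∑ k : Fin 4, K n z 0 k * Complex.I ^ (k : ℕ)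

/-- `g_n`: spin-sector zero-momentum coefficient of the twisted two-point matrix at length `n` -/
def twoPointCoeff (n : ℕ) : ℂ :=
  ∑ z ∈ box 2 n, ∑ k : Fin 4, twoPoint n z 0 k * Complex.I ^ (k : ℕ)

/-- `λ₁ = 1 + 2 cos(3π/16) = Σ_k T(E,k) i^k`, the spin-sector eigenvalue of `T` -/
def lam1 : ℝ := 1 + 2 * Real.cos (3 * Real.pi / 16)

/-- `k(x) = Σ_n κ_n x^n`, the spin-sector kernel symbol at zero momentum as a power series in the fugacity -/
def kerGF (K : ℕ → Site 2 → Matrix (Fin 4) (Fin 4) ℂ) (x : ℝ) : ℂ :=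
  ∑' n : ℕ, (x : ℂ) ^ n * kerCoeff K n

/-- `χ(x) = Σ_n g_n x^n`, the spin-sector twisted susceptibility -/
def chiGF (x : ℝ) : ℂ :=
  ∑' n : ℕ, (x : ℂ) ^ n * twoPointCoeff n

/-- the crux's partial sums `Σ_{n ≤ N} x_c^n κ_n` -/
def partialSum (K : ℕ → Site 2 → Matrix (Fin 4) (Fin 4) ℂ) (N : ℕ) : ℂ :=
  ∑ n ∈ Finset.range (N + 1), (SAW.criticalFugacity : ℂ) ^ n * kerCoeff K n

/-- the gap-equation value `1 − x_c λ₁` -/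
def gapValue : ℂ := 1 - (SAW.criticalFugacity : ℂ) * ((lam1 : ℝ) : ℂ)

/-- **The repaired crux `C′`** (proposed `--restate` text for `TwistedGapEquation`, repair R1): the route's
signature VERBATIM except for `K 0 = 0 ∧` at the head of the `IsTwistedKernel` let. -/
def TwistedGapEquationR : Prop :=
  let dir : Fin 4 → Literature.Probability.LatticeModels.Site 2 := ![![1, 0], ![0, 1], ![-1, 0], ![0, -1]]; let σ : ℝ := 5 / 8; let T : Matrix (Fin 4) (Fin 4) ℂ := fun a b => if dir b = -dir a then 0 else Complex.exp (-Complex.I * σ * (Literature.Probability.LatticeModels.turning (-Literature.Probability.LatticeModels.Site.toComplex (dir a)) 0 (Literature.Probability.LatticeModels.Site.toComplex (dir b)) : ℝ)); let G : ℕ → Literature.Probability.LatticeModels.Site 2 → Matrix (Fin 4) (Fin 4) ℂ := fun n z ι κ => if n = 0 then (if z = 0 ∧ ι = κ then 1 else 0) else ∑ p ∈ ((Literature.Probability.LatticeModels.zdGraph 2).finsetWalkLength n (0 : Literature.Probability.LatticeModels.Site 2) z).filter (fun p => p.IsPath), (if p.getVert 1 = -dir ι ∨ z - p.getVert (n - 1)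 ≠ dir κ then 0 else Complex.exp (-Complex.I * σ * (Literature.Probability.LatticeModels.winding ((-Literature.Probability.LatticeModels.Site.toComplex (dir ι)) :: (p.support.map Literature.Probability.LatticeModels.Site.toComplex)) : ℝ))); let IsTwistedKernel : (ℕ → Literature.Probability.LatticeModels.Site 2 → Matrix (Fin 4) (Fin 4) ℂ) → Prop := fun K => K 0 = 0 ∧ (∀ n z, z ∉ Literature.Probability.LatticeModels.box 2 n → K n z = 0) ∧ (∀ n, 1 ≤ n → ∀ z, G n z = Matrix.of (fun ι κ => ∑ κ' : Fin 4, G (n - 1) (z - dir κ) ι κ' * T κ' κ) + ∑ m ∈ Finset.Icc 1 n, ∑ y ∈ Literature.Probability.LatticeModels.box 2 m, K m y * G (n - m) (z - y)); ∀ K : ℕ → Literature.Probability.LatticeModels.Site 2 → Matrix (Fin 4) (Fin 4) ℂ, IsTwistedKernel K → Filter.Tendsto (fun N : ℕ => ∑ n ∈ Finset.range (N + 1), (Literature.Probability.RandomPlanarGeometry.SAW.criticalFugacity : ℂ) ^ n * ∑ z ∈ Literature.Probability.LatticeModels.box 2 n, ∑ k : Fin 4, K n z 0 k * Complex.I ^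 (k : ℕ)) Filter.atTop (nhds (1 - (Literature.Probability.RandomPlanarGeometry.SAW.criticalFugacity : ℂ) * ((1 + 2 * Real.cos (3 * Real.pi / 16) : ℝ) : ℂ)))

/-- Sanity (definitional): the repaired crux over the named vocabulary. -/
theorem repaired_iff :
    TwistedGapEquationR ↔ ∀ K, IsTwistedKernel K → Tendsto (partialSum K) atTop (𝓝 gapValue) :=
  Iff.rfl

/-- Sanity (definitional): the route's crux AS TYPED differs only by the missing clause `K 0 = 0`. -/
theorem asTyped_iff :
    Summit.CriticalPhenomena.SAWScalingLimit.Theses.SAWTwistedSelfEnergy.TwistedGapEquation ↔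
      ∀ K, ((∀ n z, z ∉ box 2 n → K n z = 0) ∧
        (∀ n, 1 ≤ n → ∀ z, twoPoint n z =
          Matrix.of (fun ι κ => ∑ κ' : Fin 4, twoPoint (n - 1) (z - dir κ) ι κ' * stepMatrix κ' κ) +
            ∑ m ∈ Finset.Icc 1 n, ∑ y ∈ box 2 m, K m y * twoPoint (n - m) (z - y))) →
        Tendsto (partialSum K) atTop (𝓝 gapValue) :=
  Iff.rfl

/-! ### 2. The three stub statements -/

/-- STUB A statement — **absolute summability of the spin-sector kernel symbol at `x_c`** (Tauberian input):
`Σ_n x_c^n |κ_n| < ∞`.  The spin-sector, zero-momentum shadow of the route's rank-2 crux `TwistedKernelSummable`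
(triangle inequality), the declared dep of this crux. -/
def SpinKernelSummable : Prop :=
  ∀ K, IsTwistedKernel K → Summable (fun n : ℕ => SAW.criticalFugacity ^ n * ‖kerCoeff K n‖)

/-- STUB B statement — **subcritical spin-sector resolvent identity**: for `0 < x < x_c`, if `Σ |κ_n| x^n < ∞`
then `Σ |g_n| x^n < ∞` and `χ(x) · (1 − x λ₁ − k(x)) = 1`.  Content: 90°-rotation covariance of `Σ_z G_n(z)`
makes the spin vector `(i^k)_k` an eigen-direction, so the matrix recursion collapses to the scalar renewal
equation `g_n = λ₁ g_{n−1} + Σ_{m=1}^n κ_m g_{n−m}`, `g_0 = 1`; `|g_n| ≤ c_n`, `c_n^{1/n} → μ` (`SAW.Zd.tendsto_count_rpow`)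
give the radius `x_c`; Cauchy product. -/
def SpinResolventIdentity : Prop :=
  ∀ K, IsTwistedKernel K → ∀ x : ℝ, 0 < x → x < SAW.criticalFugacity →
    Summable (fun n : ℕ => x ^ n * ‖kerCoeff K n‖) →
      Summable (fun n : ℕ => x ^ n * ‖twoPointCoeff n‖) ∧
        chiGF x * (1 - (x : ℂ) * ((lam1 : ℝ) : ℂ) - kerGF K x) = 1

/-- STUB C statement — **the spin-`3/8`-twisted susceptibility diverges at the untwisted critical point**:
`‖χ(x)‖ → ∞` as `x ↑ x_c`.  (`g_n = Σ_ω e^{i(3/8)W(ω)}` over `n`-step SAWs from `0` not starting West, real by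
reflection symmetry; the critical-point identification of the line.) -/
def SpinSusceptibilityDiverges : Prop :=
  Tendsto (fun x : ℝ => ‖chiGF x‖) (𝓝[<] SAW.criticalFugacity) atTop

-- END OF STATEMENTS (the BC3 probe files copy the file up to this line)

/-! ### 3. The registered stubs (the only `sorry`s of the file) -/

/-- STUB A (research-open): `Σ_n x_c^n |κ_n| < ∞`.  Why plausibly true: it follows from the route's rank-2 crux
`TwistedKernelSummable` (restated with R1) by `|κ_n| ≤ Σ_z Σ_{ι,κ} |K_n(z)(ι,κ)|`; route numerics
`x_c^n ‖K_n‖_ℓ¹ = 0.136 … 0.080` (even `n ≤ 14`), effective exponent `0.77` and rising.  Why it might fail: the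
rank-2 crux's own risk (no small parameter in `d = 2`; summability needs the exponent to pass `1`). -/
theorem stub_spinKernelSummable : SpinKernelSummable := by
  sorry

/-- STUB B (M/L, provable now in principle): the subcritical resolvent identity in the spin sector.  Why plausibly
true: exact algebra (renewal equation from rotation covariance, checked numerically to `1e−12` by the grounder on
stmt-17872) plus the elementary radius bound `|g_n| ≤ c_n ≤ (μ+ε)^n`.  Why it might fail: only through a
convention slip (orientation of `turning`, the `i^k` weights vs `dir = [E,N,W,S]`) — the refuter's review
replicated `λ₁ = Σ_k T(E,k) i^k = 1 + 2cos(3π/16)` for exactly these conventions. -/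
theorem stub_spinResolventIdentity : SpinResolventIdentity := by
  sorry

/-- STUB C (research-open): divergence of the spin-`3/8`-twisted susceptibility at `x_c`.  Why plausibly true:
SAW endpoint-tangent windings at length `n` are `O(√log n)` (Duplantier–Saleur), so the phases `e^{i(3/8)W}` cost a
power `n^{−η}` with `η ≪ γ = 43/32`, and `Σ c_n n^{−η} x^n` still diverges at `x_c` (`c_n ≥ μ^n`).  Why it might
fail: no rigorous control of SAW windings exists; a proof needs a positive-density set of walks with `|W| < 4π/3`
in the `x_c`-weighted sense (bridges do not obviously supply it). -/
theorem stub_spinSusceptibilityDiverges : SpinSusceptibilityDiverges := by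
  sorry

/-! ### Name-keyed aliases of the stub statements (hypotheses of the composition) -/
namespace Registered

/-- Alias keyed by the registered stub name. -/
abbrev stub_spinKernelSummable : Prop := SpinKernelSummable
/-- Alias keyed by the registered stub name. -/
abbrev stub_spinResolventIdentity : Prop := SpinResolventIdentity
/-- Alias keyed by the registered stub name. -/
abbrev stub_spinSusceptibilityDiverges : Prop := SpinSusceptibilityDiverges

end Registered

/-! ### 4. The composition (kernel-checked, no `sorry`) -/

/-- **The three stubs imply the repaired crux.**  M-test continuity of `k` on `[0, x_c]` (A); on `(0, x_c)` the
identity (B) gives `1 − xλ₁ − k(x) = χ(x)⁻¹`, which tends to `0` by (C); uniqueness of limits along `𝓝[<] x_c`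
gives `k(x_c) = 1 − x_c λ₁`; absolute convergence (A) turns this into convergence of the crux's partial sums. -/
theorem TwistedGapEquationR_of (hA : Registered.stub_spinKernelSummable)
    (hB : Registered.stub_spinResolventIdentity) (hC : Registered.stub_spinSusceptibilityDiverges) :
    TwistedGapEquationR := by
  rw [repaired_iff]
  intro K hK
  -- (0) `x_c = 1/μ(ℤ²) > 0`
  have hxc : 0 < SAW.criticalFugacity := by
    have h := SAW.Zd.connectiveConstant_pos 2
    rw [SAW.Zd.connectiveConstant_two] at h
    exact inv_pos.2 h
  -- (A) absolute summability at `x_c`, hence on `[0, x_c]` by comparison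
  have hS : Summable (fun n : ℕ => SAW.criticalFugacity ^ n * ‖kerCoeff K n‖) := hA K hK
  have hSx : ∀ x : ℝ, 0 ≤ x → x ≤ SAW.criticalFugacity →
      Summable (fun n : ℕ => x ^ n * ‖kerCoeff K n‖) := by
    intro x hx0 hx1
    refine Summable.of_nonneg_of_le (fun n => by positivity) (fun n => ?_) hS
    exact mul_le_mul_of_nonneg_right (pow_le_pow_left₀ hx0 hx1 n) (norm_nonneg _)
  have hnorm : ∀ x : ℝ, 0 ≤ x → ∀ n : ℕ, ‖(x : ℂ) ^ n * kerCoeff K n‖ = x ^ n * ‖kerCoeff K n‖ := by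
    intro x hx n
    rw [norm_mul, norm_pow, Complex.norm_real, Real.norm_of_nonneg hx]
  -- Weierstrass M-test: `k` is continuous on `[0, x_c]`
  have hcont : ContinuousOn (kerGF K) (Icc 0 SAW.criticalFugacity) := by
    refine continuousOn_tsum (fun n => ?_) hS (fun n x hx => ?_)
    · exact ((Complex.continuous_ofReal.pow n).mul continuous_const).continuousOn
    · rw [hnorm x hx.1 n]
      exact mul_le_mul_of_nonneg_right (pow_le_pow_left₀ hx.1 hx.2 n) (norm_nonneg _)
  have hk : Tendsto (kerGF K) (𝓝[<] SAW.criticalFugacity) (𝓝 (kerGF K SAW.criticalFugacity)) :=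
    (hcont.continuousWithinAt ⟨hxc.le, le_rfl⟩).tendsto.mono_left
      (nhdsWithin_le_of_mem (Icc_mem_nhdsLT hxc))
  -- the gap function `1 − xλ₁ − k(x)` tends to its value at `x_c` …
  have hlin : Tendsto (fun x : ℝ => 1 - (x : ℂ) * ((lam1 : ℝ) : ℂ) - kerGF K x) (𝓝[<] SAW.criticalFugacity)
      (𝓝 (1 - (SAW.criticalFugacity : ℂ) * ((lam1 : ℝ) : ℂ) - kerGF K SAW.criticalFugacity)) := by
    have hx : Tendsto (fun x : ℝ => (x : ℂ)) (𝓝[<] SAW.criticalFugacity) (𝓝 (SAW.criticalFugacity : ℂ)) :=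
      (Complex.continuous_ofReal.tendsto _).mono_left nhdsWithin_le_nhds
    exact (tendsto_const_nhds.sub (hx.mul tendsto_const_nhds)).sub hk
  -- … and to `0`: on `(0, x_c)` it is `χ(x)⁻¹` (B), and `‖χ(x)‖ → ∞` (C)
  have hzero : Tendsto (fun x : ℝ => 1 - (x : ℂ) * ((lam1 : ℝ) : ℂ) - kerGF K x) (𝓝[<] SAW.criticalFugacity)
      (𝓝 0) := by
    have hinv : Tendsto (fun x : ℝ => (chiGF x)⁻¹) (𝓝[<] SAW.criticalFugacity) (𝓝 0) := by
      rw [tendsto_zero_iff_norm_tendsto_zero]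
      simp only [norm_inv]
      exact hC.inv_tendsto_atTop
    refine hinv.congr' (eventually_of_mem (Ioo_mem_nhdsLT hxc) fun x hx => ?_)
    obtain ⟨-, hid⟩ := hB K hK x hx.1 hx.2 (hSx x hx.1.le hx.2.le)
    exact inv_eq_of_mul_eq_one_right hid
  -- uniqueness of limits along the proper filter `𝓝[<] x_c`
  have hval : 1 - (SAW.criticalFugacity : ℂ) * ((lam1 : ℝ) : ℂ) - kerGF K SAW.criticalFugacity = 0 :=
    tendsto_nhds_unique hlin hzero
  have hval' : kerGF K SAW.criticalFugacity = gapValue := by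
    unfold gapValue
    linear_combination -hval
  -- absolute convergence at `x_c`: the partial sums converge to `k(x_c)`
  have h1 : Summable (fun n : ℕ => ‖(SAW.criticalFugacity : ℂ) ^ n * kerCoeff K n‖) := by
    simp only [hnorm _ hxc.le]
    exact hS
  have hT := ((Summable.of_norm h1).hasSum.tendsto_sum_nat).comp (tendsto_add_atTop_nat 1)
  rw [show (∑' n : ℕ, (SAW.criticalFugacity : ℂ) ^ n * kerCoeff K n) = gapValue from hval'] at hT
  exact hT

/-- Wiring check: the registered stubs feed `TwistedGapEquationR_of` as stated. -/
example : TwistedGapEquationR :=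
  TwistedGapEquationR_of stub_spinKernelSummable stub_spinResolventIdentity stub_spinSusceptibilityDiverges

end Summit.CriticalPhenomena.SAWScalingLimit.Cruxes.TwistedGapEquation.Birth

end
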